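import Summits.QuantumFields.YangMills.Theorems.BalabanUVNodesN20CoreEdgeAtShellSplitOfRecord
import Summits.QuantumFields.YangMills.Theorems.BalabanUVNodesN19TargetKeyedUnpartnered
import Summits.QuantumFields.YangMills.Theorems.BalabanUVNodesN20KeyedRelWeightSocketAtRecord13CoPH

/-!
# BalabanUVNodes ∕ N20 (NE7b) — the `hedge`-JOINT COMPANION, module 10: what N19's core edge at the SHELL SPLIT OF RECORD forces on ONE-SIDED good classes —
# FLOW-FREE (no `RAgree`), EVERY policy: a good (2.18) history of one run whose σ-key is hit by NO history of the other run has VANISHING TERM CORE, i.e. its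
# (2.18) term RE-TESTED AT THE LOWERED THRESHOLD carries NO dressed mass — n19-d's «one-sided classes are pure shell» (LOCATED-U5d-2) read at the record

Cell `pub-ymgap` (HUMAN RULING D-0062 Track A; D-0149 width push), seat `pub-ymgap-dag-n20-w3` (WIDTH SEAT 3 of 3 on NODE n20 = NE7b) gen 2, INTENT-9 (pub-ymgap INBOX).
Modules 7–9 of this seat read the core edge at dag-n21-d's shell split of record under node U5d's flow hypothesis `hR : RAgree` (option (c)), under which every
class is TWO-SIDED (run B's keys ⊆ run A's keys, and conversely by dag-n20-d's section `liftSeq` — n19-d `…N19TargetKeyedUnpartnered` §4).  OFF that hypothesis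
(the jump window of (2.5)'s integer radii `RkOfRecord`, node00-def-RR-2 WORD-U5d; n20-w2's flow-free `truncShift ∕ liftShift` files) ONE-SIDED good classes can occur:
run-A indices whose σ-key no run-B index blocks down to, and run-B keys no run-A index carries.  n19-d g18 proved GENERICALLY (`left_eq_shell_of_right_eq_zero` ∕
`right_eq_shell_of_left_eq_zero`, from `h21 ∧ hedge`) that such classes are PURE SHELL.  This module types that AT THE RECORD'S OBJECTS with the shell split OF RECORD and
reads it through dag-n21-d's §3b identity: pure shell = «the term re-tested at `ε_k(1 − ρ)` integrates to ZERO».  No flow hypothesis anywhere in this file.  Filed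
`--kind proof --supports stmt-QuantumFields-20544 --as helper` (K3⁷ `SpineGivenEndpointR13SepCoPH`); COUNT-NEUTRAL.  [III] = [Balaban1988Convergent], [LF-I∕II] =
[Balaban1989LargeFieldI∕II].

WHAT IS PROVED (bookkeeping: empty-fibre sums, n20-w1's `keyA₁₃∕keyB₁₃_mem_classSet₁₃` (p588277), module 7 §1's dictionary and sign lemma, one `Finset.sum_eq_zero_iff_of_nonneg`, dag-n21-d's §3b rewrite).
* §1 `weightB₁₃_eq_zero_of_not_mem_image` ∕ `shellB₁₃_eq_zero_of_not_mem_image` ∕ `weightA₁₃_…` ∕ `shellA₁₃_…`: over a key outside a run's key image that run's keyed class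
  weight and keyed shell part of record VANISH (n19-d `sum_filter_key_eq_zero_of_not_mem_image`).
* §2 ★★ `termCoreA_eq_zero_of_core_of_not_mem_imageB`: IF `NE7.Core l₀ vol (classSet₁₃ …) (badClass₁₃ … jcut) (weightA₁₃ − shellA₁₃ ρA) (weightB₁₃ − shellB₁₃ ρB) δ` (the
  core-edge hypothesis of dag-n20-d's transfer at `sh := shellSplitOfRecord₁₃At N K₀ ρA ρB`, ANY policy, ANY `l₀, vol, δ`) THEN every run-A index `s` with `|t| ≤ l₀`, σ-key
  OFF the persistence class and hit by NO run-B key has `cw_A(s) − σ_A(s) = 0` (F3's (e1) integrability displayed for the sign); ★★ `loweredTermA_eq_zero_…`: under (H-U)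
  and `0 ≤ ε_k·ρA`, `∫ χ_k^{ε_k(1−ρA)}(Ω_k(s))·slot^t_k(s) dV_k = 0`.  ★★ `termCoreB_eq_zero_of_core_of_not_mem_imageA` ∕ `loweredTermB_eq_zero_…`: dually, every run-B
  index `s'` whose key of record is good and carried by NO run-A index has `cw_B(s') − σ_B(s') = 0` ∕ zero lowered-threshold weight (the block-down fibre's cores are
  non-negative and sum to `≤ 0`, so EACH vanishes).
LOCATED READING (sharpening n19-d's LOCATED-U5d-2 at the split of record): a prover of K3⁷'s stub 2 at the witness `(jc, shellSplitOfRecord₁₃At …)` who does NOT supply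
the flow agreement on the window must arrange, for every one-sided history, ONE of: (a) the policy `jc` marks it bad (N20's `RelWeightBound` then pays for its mass),
(b) its lowered small-field event `{χ_k^{ε_k(1−ρ)}(s) = 1}` carries no dressed mass at all (`∫ … = 0` — with F3's slots non-negative this says the event is
slot-null), — there is no third option; with the flow agreement (node U5d's section, n19-d §4) no one-sided class exists and the question is void.

HONEST FRAMING.  Count-neutral bookkeeping; nothing re-typed; NO estimate proved or asserted; `NE7.Core` is a HYPOTHESIS of every §2 theorem (N19's content, NOT PRINTED
for `d = 4`, NOT proved; inhabited by no Bałaban family today — A2 declared; the one-sided premises are inhabited exactly on the jump window — A6: conditional, declared).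
(α) READING banner as in modules 2∕4∕5∕7 (NC-NE7b-α UNRULED).  NE7 ∕ NE7b ∕ NE7c NOT PRINTED ∕ NOT PROVED; (α)-instance 0∕1; N19 ∕ N20 ∕ N21 NOT discharged; K3⁷ NOT closed;
counts unmoved (typed 28∕28 · discharged 5∕27); no count claim.  One finite `𝕋⁴_{L^K}` programme at fixed `ε = L^{−K}` along two consecutive cutoffs, Bałaban AS PRINTED;
the YM mass gap (Clay) is NOT proved by any of this — R4 closes the conditional finite-𝕋⁴ rung `BalabanLadder.UV` only; NOT ℝ⁴, NOT OS.  No `instance`, no `notation`, no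
`def`, no `sorry`, no private decls.  Sources (bookkeeping): [III] (2.1) p.254, (2.5) p.255, (2.17)–(2.18) p.257; [LF-I] (0.2)–(0.4) p.176, p.193; [LF-II] Thm 1 + (0.1)
pp.355–356, (1.80) p.384; [King1986] (3.10)–(3.13) pp.656–657.
-/

noncomputable section

namespace Summit.QuantumFields.YangMills.BalabanUVNodes.N20CoreEdgeAtShellSplitOneSided

open Literature.MathematicalPhysics.QuantumFieldTheory.Balaban1983to89 Literature.MathematicalPhysics.QuantumFieldTheory.Balaban1983to89.T4Continuum
open Literature.MathematicalPhysics.QuantumFieldTheory.Balaban1983to89.Node00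
open scoped BigOperators
open MeasureTheory
open B14.Eq218Concrete Summit.QuantumFields.BalabanUV.T4Continuum.Spine
open YMDAG.UVSplit (crOfRecord₁₃At crOfRecord₁₃VAt crOfRecord₁₃ ShellSplit₁₃CoPH keyA₁₃ keyB₁₃ keyB₁₃_eq runA₁₃ runB₁₃ histA₁₃ histB₁₃ classSet₁₃
  weightA₁₃ weightB₁₃ badClass₁₃)
open Summit.QuantumFields.YangMills.Theorems.N21ShellSplitOfRecord13CoPH
open Summit.QuantumFields.YangMills.BalabanUVNodes.N20CoreEdgeAtShellSplit
open Summit.QuantumFields.YangMills.BalabanUVNodes.N19TargetKeyedUnpartnered (sum_filter_key_eq_zero_of_not_mem_image)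
open Summit.QuantumFields.YangMills.BalabanUVNodes.N21KeyedShellWeightShellZero (zeta_nonneg_of_provisos₁₃CoPH)
open Summit.QuantumFields.YangMills.BalabanUVNodes.N20KeyedRelWeightSocketAtRecord13CoPH (keyA₁₃_mem_classSet₁₃ keyB₁₃_mem_classSet₁₃)

variable {F : T4Family} {N : ℕ} [NeZero N]
variable (θ : Stage13HParams F N) (hP : θ.Provisos₁₃CoPH F N) (K₀ : ℕ) (g₀ : ℕ → ℝ) (os : List (ULoop F))

/-! ## §1 Over a key that NO run-B index hits, run B's keyed objects of record vanish; dually for run A — FLOW-FREE -/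

/-- Over a key outside run B's key image, run B's keyed class weight of record is `0` (empty fibre). [cite: Balaban1988Convergent, (2.18) p.257 (bookkeeping)] -/
theorem weightB₁₃_eq_zero_of_not_mem_image (K : ℕ) (t : ℝ) {x : Σ K, SiteSeqKey F (K₀ + K)}
    (hx : letI : ∀ Kc, DecidableEq (SiteSeqKey F Kc) := fun _ => Classical.decEq _
      x ∉ Finset.univ.image (keyB₁₃ θ K₀ g₀ K)) :
    weightB₁₃ θ hP K₀ g₀ os K t x = 0 := by
  letI : ∀ Kc, DecidableEq (SiteSeqKey F Kc) := fun _ => Classical.decEq _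
  unfold weightB₁₃
  exact sum_filter_key_eq_zero_of_not_mem_image _ _ hx

/-- Over a key outside run B's key image, run B's keyed shell part of record is `0`. [cite: Balaban1988Convergent, (2.18) p.257 (bookkeeping)] -/
theorem shellB₁₃_eq_zero_of_not_mem_image (ρ : ℕ → ℝ) (K : ℕ) (t : ℝ) {x : Σ K, SiteSeqKey F (K₀ + K)}
    (hx : letI : ∀ Kc, DecidableEq (SiteSeqKey F Kc) := fun _ => Classical.decEq _
      x ∉ Finset.univ.image (keyB₁₃ θ K₀ g₀ K)) :
    shellB₁₃ θ hP K₀ g₀ os ρ K t x = 0 := by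
  letI : ∀ Kc, DecidableEq (SiteSeqKey F Kc) := fun _ => Classical.decEq _
  unfold shellB₁₃
  exact sum_filter_key_eq_zero_of_not_mem_image _ _ hx

/-- Over a key outside run A's key image, run A's keyed class weight of record is `0`. [cite: Balaban1988Convergent, (2.18) p.257 (bookkeeping)] -/
theorem weightA₁₃_eq_zero_of_not_mem_image (K : ℕ) (t : ℝ) {x : Σ K, SiteSeqKey F (K₀ + K)}
    (hx : letI : ∀ Kc, DecidableEq (SiteSeqKey F Kc) := fun _ => Classical.decEq _
      x ∉ Finset.univ.image (keyA₁₃ θ K₀ g₀ K)) :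
    weightA₁₃ θ hP K₀ g₀ os K t x = 0 := by
  letI : ∀ Kc, DecidableEq (SiteSeqKey F Kc) := fun _ => Classical.decEq _
  unfold weightA₁₃
  exact sum_filter_key_eq_zero_of_not_mem_image _ _ hx

/-- Over a key outside run A's key image, run A's keyed shell part of record is `0`. [cite: Balaban1988Convergent, (2.18) p.257 (bookkeeping)] -/
theorem shellA₁₃_eq_zero_of_not_mem_image (ρ : ℕ → ℝ) (K : ℕ) (t : ℝ) {x : Σ K, SiteSeqKey F (K₀ + K)}
    (hx : letI : ∀ Kc, DecidableEq (SiteSeqKey F Kc) := fun _ => Classical.decEq _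
      x ∉ Finset.univ.image (keyA₁₃ θ K₀ g₀ K)) :
    shellA₁₃ θ hP K₀ g₀ os ρ K t x = 0 := by
  letI : ∀ Kc, DecidableEq (SiteSeqKey F Kc) := fun _ => Classical.decEq _
  unfold shellA₁₃
  exact sum_filter_key_eq_zero_of_not_mem_image _ _ hx

/-! ## §2 What the core edge at the shell split of record forces on ONE-SIDED good classes — FLOW-FREE, every policy -/

section OneSided

variable (jcut : ℕ → ℕ) (ρA ρB : ℕ → ℝ) {l₀ vol : ℝ} {δ : ℕ → ℝ}

/-- **★★ A GOOD RUN-A HISTORY WITHOUT RUN-B PARTNER HAS VANISHING TERM CORE** — FLOW-FREE (no `RAgree`), EVERY policy: if the core edge holds at the shell split of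
record and the σ-key of a run-A (2.18) index `s` is off the persistence class but is hit by NO run-B index (a class on the jump window of (2.5)'s `RkOfRecord`,
node00-def-RR-2's WORD-U5d ∕ n19-d LOCATED-U5d-2), then `cw_A(s) = σ_A(s)`: the term is PURE SHELL (sign from F3's (e1) integrability + the ζ-rows).
[cite: King1986, (3.10) p.656; Balaban1988Convergent, (2.5) p.255, (2.18) p.257; Balaban1989LargeFieldI, p.193 (bookkeeping)] -/
theorem termCoreA_eq_zero_of_core_of_not_mem_imageB
    (hintA : ∀ (K : ℕ) (t : ℝ) (s : SeqOfRecord F θ.ν θ.τ9.M (histA₁₃ θ K₀ g₀ K) (K₀ + K) (K₀ + K)),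
      Integrable (fun V => chiSeqOfRecord F N θ.ν θ.τ9.M (histA₁₃ θ K₀ g₀ K) (K₀ + K) (K₀ + K) s V *
        dressedSlotsOfDatum₉ F N θ.toStage9Params (datumOfRecord₁₃CoPH F N θ hP) g₀ os t (runA₁₃ F K₀ g₀ K) (histA₁₃ θ K₀ g₀ K) (K₀ + K) s V)
        (fieldMeasure (F.P (K₀ + K)) (K₀ + K) (Node00.SU N)))
    (hcore : letI : DecidableEq (Σ K, SiteSeqKey F (K₀ + K)) := Classical.decEq _
      NE7.Core l₀ vol (classSet₁₃ θ K₀ g₀) (badClass₁₃ θ K₀ g₀ jcut)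
        (fun K t x => weightA₁₃ θ hP K₀ g₀ os K t x - shellA₁₃ θ hP K₀ g₀ os ρA K t x)
        (fun K t x => weightB₁₃ θ hP K₀ g₀ os K t x - shellB₁₃ θ hP K₀ g₀ os ρB K t x) δ)
    (K : ℕ) {t : ℝ} (ht : |t| ≤ l₀) (s : SeqOfRecord F θ.ν θ.τ9.M (histA₁₃ θ K₀ g₀ K) (K₀ + K) (K₀ + K))
    (hgood : (⟨K, twoRunKeyA F θ.ν θ.τ9.M (histA₁₃ θ K₀ g₀ K) (K₀ + K) (K₀ + K) s⟩ : Σ K, SiteSeqKey F (K₀ + K)) ∉ badClass₁₃ θ K₀ g₀ jcut K t)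
    (hunp : letI : ∀ Kc, DecidableEq (SiteSeqKey F Kc) := fun _ => Classical.decEq _
      (⟨K, twoRunKeyA F θ.ν θ.τ9.M (histA₁₃ θ K₀ g₀ K) (K₀ + K) (K₀ + K) s⟩ : Σ K, SiteSeqKey F (K₀ + K)) ∉ Finset.univ.image (keyB₁₃ θ K₀ g₀ K)) :
    classWeightOfDatum₉ F N θ.toStage9Params (datumOfRecord₁₃CoPH F N θ hP) g₀ os (runA₁₃ F K₀ g₀ K) (histA₁₃ θ K₀ g₀ K) (K₀ + K) t s
      - shellWeightOfDatum₉ F N θ.toStage9Params (datumOfRecord₁₃CoPH F N θ hP) g₀ os (runA₁₃ F K₀ g₀ K) (histA₁₃ θ K₀ g₀ K) (K₀ + K) (ρA K) t s = 0 := by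
  letI : ∀ Kc, DecidableEq (SiteSeqKey F Kc) := fun _ => Classical.decEq _
  letI : DecidableEq (Σ K, SiteSeqKey F (K₀ + K)) := Classical.decEq _
  obtain ⟨c, hc⟩ := hcore K
  have h := (hc t ht (⟨K, twoRunKeyA F θ.ν θ.τ9.M (histA₁₃ θ K₀ g₀ K) (K₀ + K) (K₀ + K) s⟩ : Σ K, SiteSeqKey F (K₀ + K))
    (Finset.mem_sdiff.2 ⟨keyA₁₃_mem_classSet₁₃ θ K₀ g₀ K s, hgood⟩)).1
  simp only at h
  rw [weightB₁₃_eq_zero_of_not_mem_image θ hP K₀ g₀ os K t hunp, shellB₁₃_eq_zero_of_not_mem_image θ hP K₀ g₀ os ρB K t hunp, sub_zero,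
    shellA₁₃_keyA θ hP K₀ g₀ os ρA K t s, weightA₁₃_keyA θ hP K₀ g₀ os K t s] at h
  have h0 : 0 ≤ classWeightOfDatum₉ F N θ.toStage9Params (datumOfRecord₁₃CoPH F N θ hP) g₀ os (runA₁₃ F K₀ g₀ K) (histA₁₃ θ K₀ g₀ K) (K₀ + K) t s
      - shellWeightOfDatum₉ F N θ.toStage9Params (datumOfRecord₁₃CoPH F N θ hP) g₀ os (runA₁₃ F K₀ g₀ K) (histA₁₃ θ K₀ g₀ K) (K₀ + K) (ρA K) t s := by
    have := weightA₁₃_sub_shellA₁₃_nonneg θ hP K₀ g₀ os ρA hintA K t ⟨K, twoRunKeyA F θ.ν θ.τ9.M (histA₁₃ θ K₀ g₀ K) (K₀ + K) (K₀ + K) s⟩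
    rwa [shellA₁₃_keyA θ hP K₀ g₀ os ρA K t s, weightA₁₃_keyA θ hP K₀ g₀ os K t s] at this
  have hexp := Real.exp_pos (c - vol * δ K)
  nlinarith

/-- **★★ THE SAME, READ AT THE LOWERED THRESHOLD**: under (H-U) and `0 ≤ ε_k·ρA`, such a history's (2.18) term RE-TESTED at `ε_k(1 − ρA)` VANISHES —
`∫ χ_k^{ε_k(1−ρA)}(Ω_k(s))·slot^t_k(s) dV_k = 0`: its lowered small-field event carries NO dressed mass (dag-n21-d §3b `classWeight_sub_shellWeight_eq_lowered`).
[cite: King1986, (3.10) p.656; Balaban1988Convergent, (2.5) p.255, (2.17)–(2.18) p.257; Balaban1989LargeFieldI, p.193 (bookkeeping)] -/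
theorem loweredTermA_eq_zero_of_core_of_not_mem_imageB (hU : LocalBgMeasurable F N θ.ν)
    (hρA : ∀ K, 0 ≤ epsOfRecord θ.ν (histA₁₃ θ K₀ g₀ K) (K₀ + K) * ρA K)
    (hintA : ∀ (K : ℕ) (t : ℝ) (s : SeqOfRecord F θ.ν θ.τ9.M (histA₁₃ θ K₀ g₀ K) (K₀ + K) (K₀ + K)),
      Integrable (fun V => chiSeqOfRecord F N θ.ν θ.τ9.M (histA₁₃ θ K₀ g₀ K) (K₀ + K) (K₀ + K) s V *
        dressedSlotsOfDatum₉ F N θ.toStage9Params (datumOfRecord₁₃CoPH F N θ hP) g₀ os t (runA₁₃ F K₀ g₀ K) (histA₁₃ θ K₀ g₀ K) (K₀ + K) s V)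
        (fieldMeasure (F.P (K₀ + K)) (K₀ + K) (Node00.SU N)))
    (hcore : letI : DecidableEq (Σ K, SiteSeqKey F (K₀ + K)) := Classical.decEq _
      NE7.Core l₀ vol (classSet₁₃ θ K₀ g₀) (badClass₁₃ θ K₀ g₀ jcut)
        (fun K t x => weightA₁₃ θ hP K₀ g₀ os K t x - shellA₁₃ θ hP K₀ g₀ os ρA K t x)
        (fun K t x => weightB₁₃ θ hP K₀ g₀ os K t x - shellB₁₃ θ hP K₀ g₀ os ρB K t x) δ)
    (K : ℕ) {t : ℝ} (ht : |t| ≤ l₀) (s : SeqOfRecord F θ.ν θ.τ9.M (histA₁₃ θ K₀ g₀ K) (K₀ + K) (K₀ + K))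
    (hgood : (⟨K, twoRunKeyA F θ.ν θ.τ9.M (histA₁₃ θ K₀ g₀ K) (K₀ + K) (K₀ + K) s⟩ : Σ K, SiteSeqKey F (K₀ + K)) ∉ badClass₁₃ θ K₀ g₀ jcut K t)
    (hunp : letI : ∀ Kc, DecidableEq (SiteSeqKey F Kc) := fun _ => Classical.decEq _
      (⟨K, twoRunKeyA F θ.ν θ.τ9.M (histA₁₃ θ K₀ g₀ K) (K₀ + K) (K₀ + K) s⟩ : Σ K, SiteSeqKey F (K₀ + K)) ∉ Finset.univ.image (keyB₁₃ θ K₀ g₀ K)) :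
    ∫ V, chiSeqOfRecordAt F N θ.ν θ.τ9.M (histA₁₃ θ K₀ g₀ K) (K₀ + K) (K₀ + K) (epsOfRecord θ.ν (histA₁₃ θ K₀ g₀ K) (K₀ + K) * (1 - ρA K)) s V *
        dressedSlotsOfDatum₉ F N θ.toStage9Params (datumOfRecord₁₃CoPH F N θ hP) g₀ os t (runA₁₃ F K₀ g₀ K) (histA₁₃ θ K₀ g₀ K) (K₀ + K) s V
        ∂fieldMeasure (F.P (K₀ + K)) (K₀ + K) (Node00.SU N) = 0 := by
  have h := termCoreA_eq_zero_of_core_of_not_mem_imageB θ hP K₀ g₀ os jcut ρA ρB hintA hcore K ht s hgood hunp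
  rw [classWeight_sub_shellWeight_eq_lowered F N θ.toStage9Params (datumOfRecord₁₃CoPH F N θ hP) g₀ os (runA₁₃ F K₀ g₀ K) (histA₁₃ θ K₀ g₀ K) (K₀ + K)
      hU (hρA K) t s (hintA K t s)] at h
  exact h

/-- **★★ A GOOD RUN-B CLASS WITHOUT RUN-A PARTNER HAS VANISHING TERM CORES, TERM BY TERM** — FLOW-FREE, EVERY policy: if run B's key of record of `s'` is off the
persistence class and is hit by NO run-A index, then EVERY run-B index `s''` over that key (in particular `s'` itself) has `cw_B(s'') = σ_B(s'')` (the block-down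
fibre's cores are non-negative and sum to `0`). [cite: King1986, (3.10) p.656; Balaban1988Convergent, (2.5) p.255, (2.18) p.257; Balaban1989LargeFieldI, p.193 (bookkeeping)] -/
theorem termCoreB_eq_zero_of_core_of_not_mem_imageA
    (hintB : ∀ (K : ℕ) (t : ℝ) (s' : SeqOfRecord F θ.ν θ.τ9.M (histB₁₃ θ K₀ g₀ K) (K₀ + K + 1) (K₀ + K + 1)),
      Integrable (fun V => chiSeqOfRecord F N θ.ν θ.τ9.M (histB₁₃ θ K₀ g₀ K) (K₀ + K + 1) (K₀ + K + 1) s' V *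
        dressedSlotsOfDatum₉ F N θ.toStage9Params (datumOfRecord₁₃CoPH F N θ hP) g₀ os t (runB₁₃ F K₀ g₀ K) (histB₁₃ θ K₀ g₀ K) (K₀ + K + 1) s' V)
        (fieldMeasure (F.P (K₀ + K + 1)) (K₀ + K + 1) (Node00.SU N)))
    (hcore : letI : DecidableEq (Σ K, SiteSeqKey F (K₀ + K)) := Classical.decEq _
      NE7.Core l₀ vol (classSet₁₃ θ K₀ g₀) (badClass₁₃ θ K₀ g₀ jcut)
        (fun K t x => weightA₁₃ θ hP K₀ g₀ os K t x - shellA₁₃ θ hP K₀ g₀ os ρA K t x)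
        (fun K t x => weightB₁₃ θ hP K₀ g₀ os K t x - shellB₁₃ θ hP K₀ g₀ os ρB K t x) δ)
    (K : ℕ) {t : ℝ} (ht : |t| ≤ l₀) (s' : SeqOfRecord F θ.ν θ.τ9.M (histB₁₃ θ K₀ g₀ K) (K₀ + K + 1) (K₀ + K + 1))
    (hgood : keyB₁₃ θ K₀ g₀ K s' ∉ badClass₁₃ θ K₀ g₀ jcut K t)
    (hunp : letI : ∀ Kc, DecidableEq (SiteSeqKey F Kc) := fun _ => Classical.decEq _
      keyB₁₃ θ K₀ g₀ K s' ∉ Finset.univ.image (keyA₁₃ θ K₀ g₀ K)) :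
    classWeightOfDatum₉ F N θ.toStage9Params (datumOfRecord₁₃CoPH F N θ hP) g₀ os (runB₁₃ F K₀ g₀ K) (histB₁₃ θ K₀ g₀ K) (K₀ + K + 1) t s'
      - shellWeightOfDatum₉ F N θ.toStage9Params (datumOfRecord₁₃CoPH F N θ hP) g₀ os (runB₁₃ F K₀ g₀ K) (histB₁₃ θ K₀ g₀ K) (K₀ + K + 1) (ρB K) t s' = 0 := by
  letI : ∀ Kc, DecidableEq (SiteSeqKey F Kc) := fun _ => Classical.decEq _
  letI : DecidableEq (Σ K, SiteSeqKey F (K₀ + K)) := Classical.decEq _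
  obtain ⟨c, hc⟩ := hcore K
  have h := (hc t ht _ (Finset.mem_sdiff.2 ⟨keyB₁₃_mem_classSet₁₃ θ K₀ g₀ K s', hgood⟩)).2
  simp only at h
  rw [weightA₁₃_eq_zero_of_not_mem_image θ hP K₀ g₀ os K t hunp, shellA₁₃_eq_zero_of_not_mem_image θ hP K₀ g₀ os ρA K t hunp, sub_zero,
    mul_zero] at h
  -- the run-B fibre core over this key is a sum of non-negative term cores, and it is `≤ 0`
  have hsum : weightB₁₃ θ hP K₀ g₀ os K t (keyB₁₃ θ K₀ g₀ K s') - shellB₁₃ θ hP K₀ g₀ os ρB K t (keyB₁₃ θ K₀ g₀ K s') =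
      ∑ s'' ∈ Finset.univ.filter (fun s'' : SeqOfRecord F θ.ν θ.τ9.M (histB₁₃ θ K₀ g₀ K) (K₀ + K + 1) (K₀ + K + 1) =>
          keyB₁₃ θ K₀ g₀ K s'' = keyB₁₃ θ K₀ g₀ K s'),
        (classWeightOfDatum₉ F N θ.toStage9Params (datumOfRecord₁₃CoPH F N θ hP) g₀ os (runB₁₃ F K₀ g₀ K) (histB₁₃ θ K₀ g₀ K) (K₀ + K + 1) t s''
          - shellWeightOfDatum₉ F N θ.toStage9Params (datumOfRecord₁₃CoPH F N θ hP) g₀ os (runB₁₃ F K₀ g₀ K) (histB₁₃ θ K₀ g₀ K) (K₀ + K + 1) (ρB K) t s'') := by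
    unfold weightB₁₃ shellB₁₃
    rw [← Finset.sum_sub_distrib]
    exact Finset.sum_congr (Finset.filter_congr_decidable _ _ _) fun _ _ => rfl
  have hnn : ∀ s'' ∈ Finset.univ.filter (fun s'' : SeqOfRecord F θ.ν θ.τ9.M (histB₁₃ θ K₀ g₀ K) (K₀ + K + 1) (K₀ + K + 1) =>
      keyB₁₃ θ K₀ g₀ K s'' = keyB₁₃ θ K₀ g₀ K s'),
      0 ≤ classWeightOfDatum₉ F N θ.toStage9Params (datumOfRecord₁₃CoPH F N θ hP) g₀ os (runB₁₃ F K₀ g₀ K) (histB₁₃ θ K₀ g₀ K) (K₀ + K + 1) t s''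
          - shellWeightOfDatum₉ F N θ.toStage9Params (datumOfRecord₁₃CoPH F N θ hP) g₀ os (runB₁₃ F K₀ g₀ K) (histB₁₃ θ K₀ g₀ K) (K₀ + K + 1) (ρB K) t s'' :=
    fun s'' _ => sub_nonneg.2 (shellWeightOfDatum₉_le_classWeight F N θ.toStage9Params (datumOfRecord₁₃CoPH F N θ hP) g₀ os (runB₁₃ F K₀ g₀ K)
      (histB₁₃ θ K₀ g₀ K) (K₀ + K + 1) (N19MGFFormAtRecord.wOfRecord₉_nonneg θ.toStage9Params (zeta_nonneg_of_provisos₁₃CoPH F θ hP) _ _)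
      (ρB K) t s'' (hintB K t s''))
  rw [hsum] at h
  have hzero := (Finset.sum_eq_zero_iff_of_nonneg hnn).1 (le_antisymm h (Finset.sum_nonneg hnn))
  exact hzero s' (Finset.mem_filter.2 ⟨Finset.mem_univ _, rfl⟩)

/-- **★★ THE SAME, READ AT THE LOWERED THRESHOLD** (run B, level `K₀ + K + 1`): `∫ χ^{ε(1−ρB)}(s')·slot^t_B(s') = 0`.
[cite: King1986, (3.10) p.656; Balaban1988Convergent, (2.5) p.255, (2.17)–(2.18) p.257; Balaban1989LargeFieldI, p.193 (bookkeeping)] -/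
theorem loweredTermB_eq_zero_of_core_of_not_mem_imageA (hU : LocalBgMeasurable F N θ.ν)
    (hρB : ∀ K, 0 ≤ epsOfRecord θ.ν (histB₁₃ θ K₀ g₀ K) (K₀ + K + 1) * ρB K)
    (hintB : ∀ (K : ℕ) (t : ℝ) (s' : SeqOfRecord F θ.ν θ.τ9.M (histB₁₃ θ K₀ g₀ K) (K₀ + K + 1) (K₀ + K + 1)),
      Integrable (fun V => chiSeqOfRecord F N θ.ν θ.τ9.M (histB₁₃ θ K₀ g₀ K) (K₀ + K + 1) (K₀ + K + 1) s' V *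
        dressedSlotsOfDatum₉ F N θ.toStage9Params (datumOfRecord₁₃CoPH F N θ hP) g₀ os t (runB₁₃ F K₀ g₀ K) (histB₁₃ θ K₀ g₀ K) (K₀ + K + 1) s' V)
        (fieldMeasure (F.P (K₀ + K + 1)) (K₀ + K + 1) (Node00.SU N)))
    (hcore : letI : DecidableEq (Σ K, SiteSeqKey F (K₀ + K)) := Classical.decEq _
      NE7.Core l₀ vol (classSet₁₃ θ K₀ g₀) (badClass₁₃ θ K₀ g₀ jcut)
        (fun K t x => weightA₁₃ θ hP K₀ g₀ os K t x - shellA₁₃ θ hP K₀ g₀ os ρA K t x)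
        (fun K t x => weightB₁₃ θ hP K₀ g₀ os K t x - shellB₁₃ θ hP K₀ g₀ os ρB K t x) δ)
    (K : ℕ) {t : ℝ} (ht : |t| ≤ l₀) (s' : SeqOfRecord F θ.ν θ.τ9.M (histB₁₃ θ K₀ g₀ K) (K₀ + K + 1) (K₀ + K + 1))
    (hgood : keyB₁₃ θ K₀ g₀ K s' ∉ badClass₁₃ θ K₀ g₀ jcut K t)
    (hunp : letI : ∀ Kc, DecidableEq (SiteSeqKey F Kc) := fun _ => Classical.decEq _
      keyB₁₃ θ K₀ g₀ K s' ∉ Finset.univ.image (keyA₁₃ θ K₀ g₀ K)) :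
    ∫ V, chiSeqOfRecordAt F N θ.ν θ.τ9.M (histB₁₃ θ K₀ g₀ K) (K₀ + K + 1) (K₀ + K + 1) (epsOfRecord θ.ν (histB₁₃ θ K₀ g₀ K) (K₀ + K + 1) * (1 - ρB K)) s' V *
        dressedSlotsOfDatum₉ F N θ.toStage9Params (datumOfRecord₁₃CoPH F N θ hP) g₀ os t (runB₁₃ F K₀ g₀ K) (histB₁₃ θ K₀ g₀ K) (K₀ + K + 1) s' V
        ∂fieldMeasure (F.P (K₀ + K + 1)) (K₀ + K + 1) (Node00.SU N) = 0 := by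
  have h := termCoreB_eq_zero_of_core_of_not_mem_imageA θ hP K₀ g₀ os jcut ρA ρB hintB hcore K ht s' hgood hunp
  rw [classWeight_sub_shellWeight_eq_lowered F N θ.toStage9Params (datumOfRecord₁₃CoPH F N θ hP) g₀ os (runB₁₃ F K₀ g₀ K) (histB₁₃ θ K₀ g₀ K) (K₀ + K + 1)
      hU (hρB K) t s' (hintB K t s')] at h
  exact h

end OneSided

end Summit.QuantumFields.YangMills.BalabanUVNodes.N20CoreEdgeAtShellSplitOneSided

end
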